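import Literature.AlgebraicGeometry.Morphisms.SectionsFlatBaseChange
import Literature.AlgebraicGeometry.Morphisms.CechH1Pullback
import HarnessLib

/-!
# Vanishing in `Ȟ¹(𝒰, 𝒪)` is insensitive to restriction of the base ring

Layer `Literature/AlgebraicGeometry/Morphisms`, namespace `Literature.AlgebraicGeometry.Morphisms`.  THEOREMS ONLY.
Cell `hodgecm-mathlib` (D-0151), F-2d road (R-def) Step (I), brick Č4a′ (author B-p07 (g15)).

For an `A`-algebra `B` and a `B`-scheme `f_Z : Z → Spec B`, the tree's Čech groups ★ `Morphisms/CechH1` of `Z` may be formed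
over `B` (`CechH1 fZ 𝒰`, a `B`-module) or over `A` through ★ `restrictBase A fZ = f_Z ≫ Spec(A → B)` (`CechH1 (restrictBase A fZ) 𝒰`,
an `A`-module).  The cochains, differentials and pullback maps are the same functions (they only see the structure sheaf), so
membership in `Ž¹`/`B̌¹`, vanishing of a class, and vanishing of a pulled-back class ★ `cechComapH1` agree.  This is the bridge
between the fibre classes of ★ `Morphisms/CechUnitCocycleResidueFibreClass` / `…FaceClass` (formed over the local ring `A`)
and the Künneth injectivity ★ `Motives/KunnethH1FibreRing` (formed over the residue field `κ`).  A cochain `η` given over `A`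
is read over `B` through the identifications ★ `Sections.equiv _ V : Sections _ V ≃+* Γ(Z, V)` (both `RingEquiv.refl`, so the
`B`-reading `ηᴮ_{ij} := (equiv fZ)⁻¹ (equiv (restrictBase A fZ)) η_{ij})` is definitionally `η_{ij}`).  [StacksProject, Tag 01ED]

* `mem_cechZ1_iff_restrictBase`, `mem_cechB1_iff_restrictBase` — same cocycles and coboundaries.
* `CechH1.mk_eq_zero_iff_restrictBase` — `[ηᴮ] = 0` over `B` iff `[η] = 0` over `A`.
* `cechComapH1_mk_eq_zero_iff_restrictBase` (any `A`-compatibility proof `hhA`; by proof irrelevance it matches the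
  consumer's) and `…'` (compatibility derived from `hh`) — `h^*[ηᴮ] = 0` over `B` iff `h^*[η] = 0` over `A`.

HC_CM is proved only modulo the 7 printed citations until rung 0 closes; nothing here is about HC.

## References
* [StacksProject] The Stacks Project, Tag 01ED (Cohomology, §20.9 Čech cohomology), Tag 01XD.
* [GortzWedhorn2023] U. Görtz, T. Wedhorn, *Algebraic Geometry II* (2023), Lemma 24.72 proof Step (I) (p. 409): the obstruction
  class is read over the residue field.
-/

noncomputable section

universe u v

open CategoryTheory AlgebraicGeometry

namespace Literature.AlgebraicGeometry.Morphisms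

variable {A B : Type u} [CommRing A] [CommRing B] [Algebra A B] {Z W : Scheme.{u}}
  (fZ : Z ⟶ Spec (.of B)) {ι : Type v} (U : ι → Z.Opens)

/-- **Same `1`-cocycles over `A` and over `B`.** [cite: StacksProject, Tag 01ED] -/
theorem mem_cechZ1_iff_restrictBase (η : CechC1 (restrictBase A fZ) U) :
    (fun i j => (Sections.equiv fZ _).symm (Sections.equiv (restrictBase A fZ) _ (η i j))) ∈ cechZ1 fZ U ↔
      η ∈ cechZ1 (restrictBase A fZ) U := by
  rw [mem_cechZ1_iff, mem_cechZ1_iff]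
  constructor <;> intro h0 <;> funext i j l
  · exact (congrFun (congrFun (congrFun h0 i) j) l :)
  · exact (congrFun (congrFun (congrFun h0 i) j) l :)

/-- **Same `1`-coboundaries over `A` and over `B`.** [cite: StacksProject, Tag 01ED] -/
theorem mem_cechB1_iff_restrictBase (η : CechC1 (restrictBase A fZ) U) :
    (fun i j => (Sections.equiv fZ _).symm (Sections.equiv (restrictBase A fZ) _ (η i j))) ∈ cechB1 fZ U ↔
      η ∈ cechB1 (restrictBase A fZ) U := by
  rw [mem_cechB1_iff, mem_cechB1_iff]
  constructor <;> rintro ⟨b, hb⟩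
  · refine ⟨fun i => (Sections.equiv (restrictBase A fZ) _).symm (Sections.equiv fZ _ (b i)), ?_⟩
    funext i j
    exact (congrFun (congrFun hb i) j :)
  · refine ⟨fun i => (Sections.equiv fZ _).symm (Sections.equiv (restrictBase A fZ) _ (b i)), ?_⟩
    funext i j
    exact (congrFun (congrFun hb i) j :)

/-- **A Čech class vanishes over `B` iff it vanishes over `A`.** [cite: StacksProject, Tag 01ED] -/
theorem CechH1.mk_eq_zero_iff_restrictBase (η : CechC1 (restrictBase A fZ) U) (hA : η ∈ cechZ1 (restrictBase A fZ) U)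
    (hB : (fun i j => (Sections.equiv fZ _).symm (Sections.equiv (restrictBase A fZ) _ (η i j))) ∈ cechZ1 fZ U) :
    CechH1.mk fZ U ⟨_, hB⟩ = 0 ↔ CechH1.mk (restrictBase A fZ) U ⟨η, hA⟩ = 0 := by
  rw [CechH1.mk_eq_zero_iff, CechH1.mk_eq_zero_iff]
  exact mem_cechB1_iff_restrictBase fZ U η

variable {fZ} (fW : W ⟶ Spec (.of B)) (h : W ⟶ Z)

/-- `h ≫ f_Z = f_W` over `B` gives the same over `A` (private plumbing). [folklore] -/
private theorem comp_restrictBase_eq (hh : h ≫ fZ = fW) : h ≫ restrictBase A fZ = restrictBase A fW := by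
  rw [restrictBase, restrictBase, ← Category.assoc, hh]

/-- **A pulled-back Čech class `h^*[η]` vanishes over `B` iff it vanishes over `A`** (the pullback of cochains ★
`cechComapC1` is `appLE` over either base). [cite: StacksProject, Tag 01ED] -/
theorem cechComapH1_mk_eq_zero_iff_restrictBase (hh : h ≫ fZ = fW)
    (hhA : h ≫ restrictBase A fZ = restrictBase A fW) (η : CechC1 (restrictBase A fZ) U)
    (hA : η ∈ cechZ1 (restrictBase A fZ) U)
    (hB : (fun i j => (Sections.equiv fZ _).symm (Sections.equiv (restrictBase A fZ) _ (η i j))) ∈ cechZ1 fZ U) :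
    cechComapH1 fZ fW h hh U (CechH1.mk fZ U ⟨_, hB⟩) = 0 ↔
      cechComapH1 (restrictBase A fZ) (restrictBase A fW) h hhA U
        (CechH1.mk (restrictBase A fZ) U ⟨η, hA⟩) = 0 := by
  rw [cechComapH1_mk_eq_zero_iff, cechComapH1_mk_eq_zero_iff,
    ← mem_cechB1_iff_restrictBase fW (preimageFamily h U)
      (cechComapC1 (restrictBase A fZ) (restrictBase A fW) h hhA U η)]
  exact Iff.rfl

/-- **A pulled-back Čech class `h^*[η]` vanishes over `B` iff it vanishes over `A`**, the `A`-compatibility `h ≫ f_Z|_A = f_W|_A`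
being derived from `h ≫ f_Z = f_W`. [cite: StacksProject, Tag 01ED] -/
theorem cechComapH1_mk_eq_zero_iff_restrictBase' (hh : h ≫ fZ = fW) (η : CechC1 (restrictBase A fZ) U)
    (hA : η ∈ cechZ1 (restrictBase A fZ) U)
    (hB : (fun i j => (Sections.equiv fZ _).symm (Sections.equiv (restrictBase A fZ) _ (η i j))) ∈ cechZ1 fZ U) :
    cechComapH1 fZ fW h hh U (CechH1.mk fZ U ⟨_, hB⟩) = 0 ↔
      cechComapH1 (restrictBase A fZ) (restrictBase A fW) h
        (by rw [restrictBase, restrictBase, ← Category.assoc, hh]) U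
        (CechH1.mk (restrictBase A fZ) U ⟨η, hA⟩) = 0 :=
  cechComapH1_mk_eq_zero_iff_restrictBase U fW h hh (comp_restrictBase_eq (A := A) fW h hh) η hA hB

end Literature.AlgebraicGeometry.Morphisms

end
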